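import Literature.Analysis.Fourier.ErdosTuranInequality
import Summits.Parity.GeneralizedHardyLittlewood.Theorems.GreenTaoLevelTwoGITwoCyclicInverseGeomSum

/-!
# Route `GreenTaoLevelTwo`, crux `MNTwo` (stmt-Parity-21276), line `birth`, stub `stub_mnVertical`:
# recurrent linear functions are major arc (GT 2008b App. A, Lemma 32 (i))

Tool for blocks V4–V5 of the `stub_mnVertical` census (B. Green, T. Tao, *Quadratic uniformity of
the Möbius function*, Ann. Inst. Fourier 58 (2008) = arXiv:math/0606087, Appendix A, Lemma 32
"Recurrent linear functions are major arc" (= Lemma (lem3.1), "which we will use extremely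
frequently"): if `‖αl‖_{ℝ/ℤ} ≤ δ₁` for at least `δ₂|I|` elements `l` of an interval `I`, with
`δ₁ ≤ δ₂/4`, then `‖qα‖_{ℝ/ℤ} ≪ δ₂^{-2}|I|^{-1}` for some `1 ≤ q ≪ δ₂^{-1}`; "the lower bound on `𝔏`
implies the discrepancy estimate … Applying (exponential-sum) [Erdős–Turán], … `|Σ_l e(q u_l)| ≥
2^{-6} δ₂² L` … the result follows" from the geometric series bound).  We follow the printed proof
with the tree's Erdős–Turán inequality (`Literature.Analysis.Fourier.TrigApprox.erdosTuran_arc`,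
Travaglini's constants) and the tree's geometric-series bound
(`…GITwoCyclicInverse.norm_sum_range_exp_mul_le`); only the absolute constants differ from print
(`q ≤ 3209/δ₂`, `‖qα‖ ≤ 10275218/(δ₂²|I|)` in place of `8/δ₂`, `2⁸/(δ₂²|I|)`).  Def-free.

* `distZ_eq_norm` — the tree's `distZ t = |t − round t|` is the norm of `t` in `ℝ/ℤ`;
* `norm_expSum_linear_mul_le` — `‖Σ_{n<L} e(dα(M+1+n))‖ · 2‖dα‖_{ℝ/ℤ} ≤ 1`;
* `card_filter_Icc_eq_card_filter_fin` — reindexing `{1,…,L}` by `Fin L`;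
* `exists_norm_mul_le_of_many_small` — **Lemma 32 (i)**.

References: [GreenTao2008QuadraticMobius] arXiv:math/0606087 App. A, Lemma 32 (i); Travaglini, LMS
Student Texts 81, Thm 7.3 (tree).
-/

noncomputable section

open Finset Real

namespace Summit.Parity.GeneralizedHardyLittlewood.GreenTaoLevelTwoMNTwoRecurrentLinear

open Literature.Analysis.Fourier.TrigApprox (e e_add norm_e expSum distZ erdosTuran_arc)
open Summit.Parity.GeneralizedHardyLittlewood.GreenTaoLevelTwoGITwoCyclicInverse
  (norm_sum_range_exp_mul_le)

/-- The tree's distance-to-the-nearest-integer `distZ t = |t − round t|` is `‖t‖_{ℝ/ℤ}`.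
[folklore] -/
theorem distZ_eq_norm (t : ℝ) : distZ t = ‖((t : ℝ) : UnitAddCircle)‖ := by
  rw [UnitAddCircle.norm_eq]; rfl

/-- Geometric-series bound for the exponential sums of a linear point set:
`‖Σ_{n<L} e(d·α(M+1+n))‖ · 2‖dα‖_{ℝ/ℤ} ≤ 1`. [folklore] -/
theorem norm_expSum_linear_mul_le (α : ℝ) (M : ℤ) (L : ℕ) (d : ℤ) :
    ‖expSum (fun n : Fin L => α * ((M : ℝ) + 1 + n)) d‖ *
        (2 * ‖((((d : ℝ) * α : ℝ)) : UnitAddCircle)‖) ≤ 1 := by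
  unfold expSum
  have h : ∑ n : Fin L, e (d * (α * ((M : ℝ) + 1 + (n : ℕ)))) =
      e (d * α * (M + 1)) *
        ∑ n ∈ range L, Complex.exp (2 * π * Complex.I * ((n : ℂ) * (((d : ℝ) * α : ℝ) : ℂ))) := by
    rw [Finset.mul_sum,
      ← Fin.sum_univ_eq_sum_range (fun n : ℕ =>
        e (d * α * (M + 1)) * Complex.exp (2 * π * Complex.I * ((n : ℂ) * (((d : ℝ) * α : ℝ) : ℂ))))]
    refine Finset.sum_congr rfl fun n _ => ?_
    rw [show (d : ℝ) * (α * ((M : ℝ) + 1 + ((n : ℕ) : ℝ))) =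
      d * α * (M + 1) + ((n : ℕ) : ℝ) * ((d : ℝ) * α) by ring, e_add]
    unfold e
    push_cast
    ring_nf
  rw [h, norm_mul, norm_e, one_mul]
  exact norm_sum_range_exp_mul_le (d * α) L

/-- Reindexing `{1, …, L}` by `Fin L` (`n ↦ n+1`). [folklore] -/
theorem card_filter_Icc_eq_card_filter_fin (L : ℕ) (P : ℕ → Prop) [DecidablePred P] :
    #((Icc 1 L).filter P) = #((Finset.univ : Finset (Fin L)).filter fun n : Fin L => P (n.val + 1)) := by
  classical
  have himg : (Finset.univ : Finset (Fin L)).image (fun n : Fin L => (n : ℕ) + 1) = Icc 1 L := by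
    ext x
    simp only [mem_image, mem_univ, true_and, mem_Icc]
    constructor
    · rintro ⟨n, rfl⟩; exact ⟨by omega, by omega⟩
    · rintro ⟨h1, h2⟩; exact ⟨⟨x - 1, by omega⟩, by simp only; omega⟩
  rw [← himg, Finset.filter_image, card_image_of_injective _ (fun a b h => by
    simp only [add_left_inj] at h; exact Fin.ext h)]

/-- **Recurrent linear functions are major arc (GT 2008b Lemma 32 (i)).**  Let `α ∈ ℝ`, `M ∈ ℤ`,
`L ≥ 1`, `0 < δ₂ ≤ 1`, `0 ≤ δ₁ ≤ δ₂/4`, and suppose that at least `δ₂ L` integers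
`l ∈ {1, …, L}` satisfy `‖α(M+l)‖_{ℝ/ℤ} ≤ δ₁`.  Then there is `1 ≤ q ≤ 3209/δ₂` with
`‖qα‖_{ℝ/ℤ} ≤ 10275218/(δ₂² L)`.
[cite: GreenTao2008QuadraticMobius, Lemma 32 (i)] -/
theorem exists_norm_mul_le_of_many_small (α : ℝ) (M : ℤ) {L : ℕ} (hL : 1 ≤ L) {δ₁ δ₂ : ℝ}
    (hδ₂ : 0 < δ₂) (hδ₂1 : δ₂ ≤ 1) (hδ₁ : 0 ≤ δ₁) (hδ₁₂ : δ₁ ≤ δ₂ / 4)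
    (hcount : δ₂ * L ≤ #((Icc 1 L).filter fun l : ℕ =>
      ‖((α * ((M : ℝ) + l) : ℝ) : UnitAddCircle)‖ ≤ δ₁)) :
    ∃ q : ℕ, 1 ≤ q ∧ (q : ℝ) ≤ 3209 / δ₂ ∧
      ‖((((q : ℝ) * α : ℝ)) : UnitAddCircle)‖ ≤ 10275218 / (δ₂ ^ 2 * L) := by
  classical
  have hLpos : (0 : ℝ) < L := by exact_mod_cast hL
  -- the point set
  set ω : Fin L → ℝ := fun n => α * ((M : ℝ) + 1 + (n : ℕ)) with hω
  -- the count, read on `Fin L`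
  have hcount' : δ₂ * L ≤
      #((Finset.univ : Finset (Fin L)).filter fun n : Fin L => distZ (ω n - 0) ≤ δ₁) := by
    rw [card_filter_Icc_eq_card_filter_fin] at hcount
    refine hcount.trans (le_of_eq ?_)
    norm_cast
    refine congrArg Finset.card (Finset.filter_congr fun n _ => ?_)
    simp only [hω, sub_zero, distZ_eq_norm]
    push_cast
    rw [show (M : ℝ) + ((n.val : ℝ) + 1) = (M : ℝ) + 1 + (n.val : ℝ) by ring]
  -- Erdős–Turán with `H = ⌈3208/δ₂⌉`
  set H : ℕ := ⌈3208 / δ₂⌉₊ with hHdef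
  have hHge : 3208 / δ₂ ≤ H := Nat.le_ceil _
  have hH1 : 1 ≤ H := by
    have : (1 : ℝ) ≤ 3208 / δ₂ := by rw [le_div_iff₀ hδ₂]; linarith
    exact_mod_cast this.trans hHge
  have hHpos : (0 : ℝ) < H := by exact_mod_cast hH1
  have hHle : (H : ℝ) ≤ 3209 / δ₂ := by
    have h1 : (H : ℝ) < 3208 / δ₂ + 1 := Nat.ceil_lt_add_one (by positivity)
    have h2 : (1 : ℝ) ≤ 1 / δ₂ := by rw [le_div_iff₀ hδ₂]; linarith
    have : 3208 / δ₂ + 1 ≤ 3209 / δ₂ := by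
      rw [div_add_one hδ₂.ne', div_le_div_iff_of_pos_right hδ₂]; linarith
    linarith
  have hET := erdosTuran_arc ω 0 hδ₁ (by linarith) hH1
  -- lower bound for the weighted exponential-sum total
  set T : ℝ := ∑ d ∈ Icc 1 H, ‖expSum ω d‖ / d with hT
  have hT0 : 0 ≤ T := Finset.sum_nonneg fun d _ => by positivity
  have hTlow : δ₂ * L / 6404 ≤ T := by
    have h1 : δ₂ * L / 2 ≤ 802 * L / H + (2 / π + 1600) * T := by
      have habs := (le_abs_self _).trans hET
      have : 2 * δ₁ * (L : ℝ) ≤ δ₂ * L / 2 := by nlinarith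
      linarith
    have h2 : 802 * (L : ℝ) / H ≤ δ₂ * L / 4 := by
      rw [div_le_div_iff₀ hHpos (by norm_num : (0 : ℝ) < 4)]
      have : 802 * 4 ≤ δ₂ * H := by
        have := mul_le_mul_of_nonneg_left hHge hδ₂.le
        rw [mul_div_cancel₀ _ hδ₂.ne'] at this
        linarith
      nlinarith
    have hπ : 2 / π + 1600 ≤ (1601 : ℝ) := by
      have : 2 / π ≤ 1 := by
        rw [div_le_one Real.pi_pos]; linarith [Real.pi_gt_three]
      linarith
    have h3 : (2 / π + 1600) * T ≤ 1601 * T := mul_le_mul_of_nonneg_right hπ hT0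
    have h4 : δ₂ * L / 4 ≤ 1601 * T := by linarith
    have : δ₂ * L / 6404 = (δ₂ * L / 4) / 1601 := by ring
    rw [this, div_le_iff₀ (by norm_num : (0 : ℝ) < 1601)]
    linarith
  -- a frequency with a large exponential sum
  obtain ⟨d₀, hd₀, hmax⟩ := Finset.exists_max_image (Icc 1 H) (fun d : ℕ => ‖expSum ω d‖ / d)
    ⟨1, by rw [mem_Icc]; exact ⟨le_rfl, hH1⟩⟩
  rw [mem_Icc] at hd₀
  have hd₀pos : (0 : ℝ) < d₀ := by exact_mod_cast hd₀.1
  have hTle : T ≤ H * (‖expSum ω d₀‖ / d₀) := by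
    calc T ≤ ∑ _d ∈ Icc 1 H, ‖expSum ω d₀‖ / d₀ := Finset.sum_le_sum fun d hd => hmax d hd
      _ = H * (‖expSum ω d₀‖ / d₀) := by
          rw [Finset.sum_const, Nat.card_Icc, nsmul_eq_mul]; push_cast; ring
  have hS : δ₂ ^ 2 * L / 20550436 ≤ ‖expSum ω d₀‖ := by
    -- `‖S(d₀)‖ ≥ ‖S(d₀)‖/d₀ ≥ T/H ≥ δ₂ L/(6404 H) ≥ δ₂² L/(6404·3209)`
    have h1 : ‖expSum ω d₀‖ / d₀ ≤ ‖expSum ω d₀‖ := by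
      rw [div_le_iff₀ hd₀pos]
      have : (1 : ℝ) ≤ d₀ := by exact_mod_cast hd₀.1
      nlinarith [norm_nonneg (expSum ω d₀)]
    have h2 : δ₂ * L / 6404 ≤ H * ‖expSum ω d₀‖ := by
      have := hTlow.trans hTle
      nlinarith [norm_nonneg (expSum ω d₀), hHpos.le]
    have h3 : (H : ℝ) * ‖expSum ω d₀‖ ≤ 3209 / δ₂ * ‖expSum ω d₀‖ :=
      mul_le_mul_of_nonneg_right hHle (norm_nonneg _)
    have h4 : δ₂ * L / 6404 ≤ 3209 / δ₂ * ‖expSum ω d₀‖ := h2.trans h3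
    rw [div_mul_eq_mul_div, le_div_iff₀ hδ₂] at h4
    have : δ₂ ^ 2 * L / 20550436 = (δ₂ * L / 6404 * δ₂) / 3209 := by ring
    rw [this, div_le_iff₀ (by norm_num : (0 : ℝ) < 3209)]
    linarith
  have hSpos : 0 < ‖expSum ω d₀‖ := lt_of_lt_of_le (by positivity) hS
  -- geometric series
  have hgeom := norm_expSum_linear_mul_le α M L d₀
  refine ⟨d₀, hd₀.1, (show (d₀ : ℝ) ≤ H by exact_mod_cast hd₀.2).trans hHle, ?_⟩
  have e1 : ((((d₀ : ℕ) : ℤ) : ℝ) * α) = (d₀ : ℝ) * α := by push_cast; ring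
  rw [e1] at hgeom
  -- `‖d₀α‖ ≤ 1/(2‖S‖) ≤ 20550436/(2 δ₂² L)`
  have h1 : ‖((((d₀ : ℝ) * α : ℝ)) : UnitAddCircle)‖ ≤ 1 / (2 * ‖expSum ω d₀‖) := by
    rw [le_div_iff₀ (by positivity)]
    linarith
  refine h1.trans ?_
  rw [div_le_div_iff₀ (by positivity) (by positivity)]
  nlinarith

end Summit.Parity.GeneralizedHardyLittlewood.GreenTaoLevelTwoMNTwoRecurrentLinear
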